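import Summits.RiemannHypothesis.RiemannHypothesis.Theorems.LiAsymptoticSmoothReplace
import HarnessLib

/-!
# RiemannHypothesis / LiTailLaguerre — Fejér companion, part 1a: the smooth zero angle and its derivatives (RH-FREE)

RH-FREE [rh-li-eng].  Cell `pub/rh-li`, round 7 (route `Theses/LiTailLaguerre.lean`, PART K
`Theorems/LiTailLaguerreDefs.lean`).  PART K types the companion `LiCoffeyTermFejer` (Fejér's asymptotic of the
Coffey–Laguerre terms `(Λ(m)/m) L¹_{n−1}(log m) = −liPrimeEcho m n + o(1)`); the files `LiTailLaguerreFejer*.lean` prove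
its BOUNDED-ERROR form `|liCoffeyTerm m n + liPrimeEcho m n| ≤ C_m` by a first-order stationary-phase evaluation of the
LAGUERRE BRIDGE integral `B_n(y) = ∫_0^∞ 2(1 − cos nθ(t)) cos(ty) dt` (`= π e^{−y/2} L¹_{n−1}(y)`, tree theorem
`Literature.Analysis.SpecialFunctions.integral_liKernel_mul_cos_Ioi`), `θ = liZeroAngle`.

This file: the smooth angle `ϑ(t) = π − 2 arctan 2t` (`= θ(t)` for `t > 0`, smooth through `t = 0`), its first four
derivatives `ϑ′ = −4/u`, `ϑ″ = 32t/u²`, `ϑ‴ = 32(1 − 12t²)/u³`, `ϑ⁗ = 1536 t(4t² − 1)/u⁴` (`u = 1 + 4t²`), and the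
bounds `ϑ″ ≥ 16/(289 s³)`, `|ϑ‴| ≤ 96/s⁴`, `|ϑ⁗| ≤ 768/s⁵` on `[s/2, 2s]` (`s ≥ 1`) that Graham–Kolesnik's Lemma 3.4
consumes.  Nothing here bears on the truth of RH.
-/

noncomputable section

-- D-0017: `Summit.<S>.<S>.…` is the designed namespace of a single-problem summit.
set_option linter.dupNamespace false

open Set

namespace Summit.RiemannHypothesis.RiemannHypothesis.Theorems.LiTheory

namespace Fejer

/-! ### The smooth angle and its derivatives -/

/-- `u(t) = 1 + 4t²`. -/
def uS (t : ℝ) : ℝ := 1 + 4 * t ^ 2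

/-- The smooth angle `ϑ(t) = π − 2 arctan(2t)` (`= liZeroAngle t = 2 arctan(1/2t)` for `t > 0`, `ϑ(0) = π`). -/
def angS (t : ℝ) : ℝ := Real.pi - 2 * Real.arctan (2 * t)

/-- `ϑ' = −4/u`. -/
def angD1 (t : ℝ) : ℝ := -4 / uS t

/-- `ϑ'' = 32t/u²`. -/
def angD2 (t : ℝ) : ℝ := 32 * t / uS t ^ 2

/-- `ϑ''' = 32(1 − 12t²)/u³`. -/
def angD3 (t : ℝ) : ℝ := 32 * (1 - 12 * t ^ 2) / uS t ^ 3

/-- `ϑ'''' = 1536 t(4t² − 1)/u⁴`. -/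
def angD4 (t : ℝ) : ℝ := 1536 * t * (4 * t ^ 2 - 1) / uS t ^ 4

/-- `u > 0`. -/
theorem uS_pos (t : ℝ) : 0 < uS t := by unfold uS; positivity

/-- `u ≥ 4t²`. -/
theorem sq_le_uS (t : ℝ) : 4 * t ^ 2 ≤ uS t := by unfold uS; linarith

/-- `ϑ = θ` on `t > 0`. -/
theorem angS_eq_liZeroAngle {t : ℝ} (ht : 0 < t) : angS t = liZeroAngle t := by
  unfold angS liZeroAngle
  rw [one_div, Real.arctan_inv_of_pos (by positivity)]
  ring

/-- `u' = 8t`. -/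
theorem hasDerivAt_uS (t : ℝ) : HasDerivAt uS (8 * t) t := by
  have h := ((hasDerivAt_pow 2 t).const_mul (4 : ℝ)).const_add (1 : ℝ)
  refine h.congr_deriv ?_
  norm_num; ring

/-- `ϑ' = angD1`. -/
theorem hasDerivAt_angS (t : ℝ) : HasDerivAt angS (angD1 t) t := by
  have h1 : HasDerivAt (fun t : ℝ ↦ 2 * t) (2 * 1) t := (hasDerivAt_id' t).const_mul 2
  have h2 := (h1.arctan).const_mul (2 : ℝ)
  have h3 := h2.const_sub Real.pi
  refine h3.congr_deriv ?_
  unfold angD1 uS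
  field_simp
  ring

/-- `ϑ'' = angD2`. -/
theorem hasDerivAt_angD1 (t : ℝ) : HasDerivAt angD1 (angD2 t) t := by
  have hu := hasDerivAt_uS t
  have hu0 := (uS_pos t).ne'
  have h := (hasDerivAt_const t (-4 : ℝ)).div hu hu0
  refine h.congr_deriv ?_
  unfold angD2
  field_simp
  ring

/-- `ϑ''' = angD3`. -/
theorem hasDerivAt_angD2 (t : ℝ) : HasDerivAt angD2 (angD3 t) t := by
  have hu := hasDerivAt_uS t
  have hu0 := (uS_pos t).ne'
  have hnum : HasDerivAt (fun t : ℝ ↦ 32 * t) (32 * 1) t := (hasDerivAt_id' t).const_mul 32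
  have hden : HasDerivAt (fun t : ℝ ↦ uS t ^ 2) (2 * uS t ^ 1 * (8 * t)) t := hu.pow 2
  have h := hnum.div hden (pow_ne_zero 2 hu0)
  refine h.congr_deriv ?_
  unfold angD3 uS
  have : (1 : ℝ) + 4 * t ^ 2 ≠ 0 := by positivity
  field_simp
  ring

/-- `ϑ'''' = angD4`. -/
theorem hasDerivAt_angD3 (t : ℝ) : HasDerivAt angD3 (angD4 t) t := by
  have hu := hasDerivAt_uS t
  have hu0 := (uS_pos t).ne'
  have hnum : HasDerivAt (fun t : ℝ ↦ 32 * (1 - 12 * t ^ 2)) (32 * (0 - 12 * (2 * t ^ 1 * 1))) t := by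
    have := ((hasDerivAt_pow 2 t).const_mul (12 : ℝ)).const_sub (1 : ℝ)
    simpa using this.const_mul (32 : ℝ)
  have hden : HasDerivAt (fun t : ℝ ↦ uS t ^ 3) (3 * uS t ^ 2 * (8 * t)) t := hu.pow 3
  have h := hnum.div hden (pow_ne_zero 3 hu0)
  refine h.congr_deriv ?_
  unfold angD4 uS
  have : (1 : ℝ) + 4 * t ^ 2 ≠ 0 := by positivity
  field_simp
  ring

/-- `ϑ'' ≥ 0` for `t ≥ 0`. -/
theorem angD2_nonneg {t : ℝ} (ht : 0 ≤ t) : 0 ≤ angD2 t := by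
  unfold angD2; have := uS_pos t; positivity

/-- Continuity of `ϑ''`. -/
theorem continuous_angD2 : Continuous angD2 := by
  have : ∀ t, uS t ^ 2 ≠ 0 := fun t ↦ pow_ne_zero 2 (uS_pos t).ne'
  unfold angD2 uS at *
  fun_prop (disch := exact fun t ↦ by positivity)

/-! ### Bounds on `[s/2, 2s]`, `s ≥ 1` -/

/-- `ϑ''(t) ≥ 16/(289 s³)` for `t ∈ [s/2, 2s]`, `s ≥ 1`. -/
theorem angD2_ge {s t : ℝ} (hs : 1 ≤ s) (ht : t ∈ Icc (s / 2) (2 * s)) : 16 / (289 * s ^ 3) ≤ angD2 t := by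
  obtain ⟨ht1, ht2⟩ := ht
  have hs0 : 0 < s := by linarith
  have ht0 : 0 < t := by linarith
  have hu : uS t ≤ 17 * s ^ 2 := by
    unfold uS; nlinarith
  have hu0 := uS_pos t
  unfold angD2
  calc 16 / (289 * s ^ 3) = 32 * (s / 2) / (17 * s ^ 2) ^ 2 := by field_simp; ring
    _ ≤ 32 * t / (17 * s ^ 2) ^ 2 := by gcongr
    _ ≤ 32 * t / uS t ^ 2 := by
        apply div_le_div_of_nonneg_left (by positivity) (by positivity)
        gcongr

/-- `|ϑ'''(t)| ≤ 96/s⁴` for `t ∈ [s/2, 2s]`, `s ≥ 1`. -/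
theorem abs_angD3_le {s t : ℝ} (hs : 1 ≤ s) (ht : t ∈ Icc (s / 2) (2 * s)) : |angD3 t| ≤ 96 / s ^ 4 := by
  obtain ⟨ht1, _⟩ := ht
  have hs0 : 0 < s := by linarith
  have ht0 : 0 < t := by linarith
  have hu0 := uS_pos t
  have hu4 := sq_le_uS t
  unfold angD3
  rw [abs_div, abs_of_pos (pow_pos hu0 3)]
  have hnum : |32 * (1 - 12 * t ^ 2)| ≤ 96 * uS t := by
    rw [abs_le]; unfold uS; constructor <;> nlinarith [sq_nonneg t]
  calc |32 * (1 - 12 * t ^ 2)| / uS t ^ 3 ≤ 96 * uS t / uS t ^ 3 := by gcongr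
    _ = 96 / uS t ^ 2 := by field_simp
    _ ≤ 96 / (4 * t ^ 2) ^ 2 := by
        apply div_le_div_of_nonneg_left (by norm_num) (by positivity)
        gcongr
    _ = 6 / t ^ 4 := by field_simp; ring
    _ ≤ 6 / (s / 2) ^ 4 := by
        apply div_le_div_of_nonneg_left (by norm_num) (by positivity)
        gcongr
    _ = 96 / s ^ 4 := by field_simp; ring

/-- `|ϑ''''(t)| ≤ 768/s⁵` for `t ∈ [s/2, 2s]`, `s ≥ 1`. -/
theorem abs_angD4_le {s t : ℝ} (hs : 1 ≤ s) (ht : t ∈ Icc (s / 2) (2 * s)) : |angD4 t| ≤ 768 / s ^ 5 := by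
  obtain ⟨ht1, _⟩ := ht
  have hs0 : 0 < s := by linarith
  have ht0 : 0 < t := by linarith
  have hu0 := uS_pos t
  have hu4 := sq_le_uS t
  unfold angD4
  rw [abs_div, abs_of_pos (pow_pos hu0 4)]
  have hnum : |1536 * t * (4 * t ^ 2 - 1)| ≤ 1536 * t * uS t := by
    rw [abs_mul, abs_of_pos (by positivity : (0:ℝ) < 1536 * t)]
    refine mul_le_mul_of_nonneg_left ?_ (by positivity)
    rw [abs_le]; unfold uS; constructor <;> nlinarith [sq_nonneg t]
  calc |1536 * t * (4 * t ^ 2 - 1)| / uS t ^ 4 ≤ 1536 * t * uS t / uS t ^ 4 := by gcongr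
    _ = 1536 * t / uS t ^ 3 := by field_simp
    _ ≤ 1536 * t / (4 * t ^ 2) ^ 3 := by
        apply div_le_div_of_nonneg_left (by positivity) (by positivity)
        gcongr
    _ = 24 / t ^ 5 := by field_simp; ring
    _ ≤ 24 / (s / 2) ^ 5 := by
        apply div_le_div_of_nonneg_left (by norm_num) (by positivity)
        gcongr
    _ = 768 / s ^ 5 := by field_simp; ring

end Fejer

end Summit.RiemannHypothesis.RiemannHypothesis.Theorems.LiTheory

end
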